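import Summits.KontsevichZagierPeriods.KontsevichZagierPeriods.Theses.SymplecticScissors
import Literature.NumberTheory.Transcendental.KZCalculusProofs
import Literature.NumberTheory.Transcendental.KZGroundingRelations
import Literature.NumberTheory.Transcendental.KZSemiCanonicalReductionProofs
import Literature.NumberTheory.Transcendental.SemialgebraicMapsProofs
import Literature.NumberTheory.Transcendental.KZLogCalculusProofs

/-!
# `PlanarAreas` (stmt-KontsevichZagierPeriods-4990), line `green-native-bands`:
# stub `stub_mixedPartials` — mixed partials of a Green potential agree off a null set

For `ℚ`-semialgebraic coefficients `A, B` on the closed standard triangle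
`Δ = {0 ≤ a, 0 ≤ b, a + b ≤ 1}` admitting a potential `S` with `dS = A da + B db` on the open
triangle `Δ°`, we produce a `ℚ`-semialgebraic Lebesgue-null set `Z` such that at every point
`p ∈ Δ° \ Z` the fibre functions `b ↦ A(a, b)` and `a ↦ B(a, b)` are differentiable with the same
derivative `∂_b A (p) = ∂_a B (p)`.

Proof: a `ℚ`-semialgebraic function on a `ℚ`-semialgebraic set is `C^∞` on an open
`ℚ`-semialgebraic subset with `ℚ`-semialgebraic null complement
(`KZ.exists_isOpen_contDiffOn`, packaging `IsSemialgebraicFunOn.exists_contDiffOn_holds`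
[Bochnak–Coste–Roy 1998, §2.9] with the nullity of frontiers and of thin semialgebraic sets,
`SemialgebraicVolume.lean`); `Z` is the union of the two exceptional sets for `A` and `B`. Off `Z`
the derivative `y ↦ A y • pr₀ + B y • pr₁` of `S` is Fréchet differentiable, so by the symmetry of
second derivatives (Mathlib's `second_derivative_symmetric_of_eventually_of_real`, which only needs
twice-differentiability at the point) `∂_b A = ∂_a B` there; the fibre derivatives are the Fréchet
derivatives of `A`, `B` along the coordinate lines (chain rule).

References: M. Kontsevich, D. Zagier, *Periods* (2001), §1.2; J. Bochnak, M. Coste, M.-F. Roy,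
*Real Algebraic Geometry* (1998), §2.9.

Design: theorems only; the exceptional set is taken relative to the CLOSED triangle (so that no
separate semialgebraicity proof of the open triangle is needed: the domain of a semialgebraic
function is semialgebraic, `IsSemialgebraicFunOn.isSemialgebraic_holds`).
-/

noncomputable section

open scoped BigOperators Topology
open Set MeasureTheory Filter
open Literature.NumberTheory.Transcendental
open Literature.ModelTheory.ExponentialFields (IsSemialgebraic)

namespace Summit.KontsevichZagierPeriods.SymplecticScissors.PlanarAreas

/-- **Symmetry of mixed partials for a potential of `A da + B db`.** If `S` has derivative
`y ↦ A y • pr₀ + B y • pr₁` near `p` and `A`, `B` are Fréchet differentiable at `p`, then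
`dA(p)[e₁] = dB(p)[e₀]`, i.e. `∂_b A (p) = ∂_a B (p)` (Schwarz–Young: a function twice Fréchet
differentiable at a point has a symmetric second derivative there). [folklore] -/
theorem fderiv_apply_single_eq_of_potential {A B S : (Fin 2 → ℝ) → ℝ} {p : Fin 2 → ℝ}
    (hS : ∀ᶠ y in 𝓝 p, HasFDerivAt S
      (A y • ContinuousLinearMap.proj (R := ℝ) (φ := fun _ : Fin 2 => ℝ) 0 +
        B y • ContinuousLinearMap.proj (R := ℝ) (φ := fun _ : Fin 2 => ℝ) 1) y)
    (hA : DifferentiableAt ℝ A p) (hB : DifferentiableAt ℝ B p) :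
    fderiv ℝ A p (Pi.single 1 1) = fderiv ℝ B p (Pi.single 0 1) := by
  have hL : HasFDerivAt (fun y : Fin 2 → ℝ =>
      A y • ContinuousLinearMap.proj (R := ℝ) (φ := fun _ : Fin 2 => ℝ) 0 +
        B y • ContinuousLinearMap.proj (R := ℝ) (φ := fun _ : Fin 2 => ℝ) 1)
      ((fderiv ℝ A p).smulRight (ContinuousLinearMap.proj (R := ℝ) (φ := fun _ : Fin 2 => ℝ) 0) +
        (fderiv ℝ B p).smulRight (ContinuousLinearMap.proj (R := ℝ) (φ := fun _ : Fin 2 => ℝ) 1))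
      p :=
    (hA.hasFDerivAt.smul_const (ContinuousLinearMap.proj (R := ℝ) (φ := fun _ : Fin 2 => ℝ) 0)).add
      (hB.hasFDerivAt.smul_const (ContinuousLinearMap.proj (R := ℝ) (φ := fun _ : Fin 2 => ℝ) 1))
  have h := second_derivative_symmetric_of_eventually_of_real hS hL (Pi.single 1 1) (Pi.single 0 1)
  simpa [ContinuousLinearMap.smulRight_apply, Pi.single_apply] using h

/-- The vertical coordinate line `s ↦ (a, s)` through `p = (a, b)` has velocity `e₁`. [folklore] -/
theorem hasDerivAt_vecCons_snd (p : Fin 2 → ℝ) (t : ℝ) :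
    HasDerivAt (fun s : ℝ => (![p 0, s] : Fin 2 → ℝ)) (Pi.single 1 1) t := by
  rw [hasDerivAt_pi]
  intro i
  fin_cases i
  · simp only [Fin.zero_eta, Fin.isValue, Matrix.cons_val_zero]
    rw [show ((Pi.single 1 1 : Fin 2 → ℝ) 0) = 0 by simp]
    exact hasDerivAt_const t (p 0)
  · simp only [Fin.mk_one, Fin.isValue, Matrix.cons_val_one, Matrix.cons_val_fin_one]
    rw [show ((Pi.single 1 1 : Fin 2 → ℝ) 1) = 1 by simp]
    exact hasDerivAt_id' t

/-- The horizontal coordinate line `s ↦ (s, b)` through `p = (a, b)` has velocity `e₀`.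
[folklore] -/
theorem hasDerivAt_vecCons_fst (p : Fin 2 → ℝ) (t : ℝ) :
    HasDerivAt (fun s : ℝ => (![s, p 1] : Fin 2 → ℝ)) (Pi.single 0 1) t := by
  rw [hasDerivAt_pi]
  intro i
  fin_cases i
  · simp only [Fin.zero_eta, Fin.isValue, Matrix.cons_val_zero]
    rw [show ((Pi.single 0 1 : Fin 2 → ℝ) 0) = 1 by simp]
    exact hasDerivAt_id' t
  · simp only [Fin.mk_one, Fin.isValue, Matrix.cons_val_one, Matrix.cons_val_fin_one]
    rw [show ((Pi.single 0 1 : Fin 2 → ℝ) 1) = 0 by simp]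
    exact hasDerivAt_const t (p 1)

/-- A point of the plane is the vector of its two coordinates. [folklore] -/
theorem vecCons_apply_eq (p : Fin 2 → ℝ) : (![p 0, p 1] : Fin 2 → ℝ) = p := by
  ext i
  fin_cases i <;> rfl

/-- **Fibre derivative along `b`** of a function Fréchet differentiable at `p`: the fibre function
`s ↦ A (p 0, s)` has derivative `dA(p)[e₁]` at `p 1` (chain rule). [folklore] -/
theorem hasDerivAt_fibre_snd {A : (Fin 2 → ℝ) → ℝ} {p : Fin 2 → ℝ} (hA : DifferentiableAt ℝ A p) :
    HasDerivAt (fun s : ℝ => A ![p 0, s]) (fderiv ℝ A p (Pi.single 1 1)) (p 1) := by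
  have h : HasFDerivAt A (fderiv ℝ A p) ![p 0, p 1] := by
    rw [vecCons_apply_eq]
    exact hA.hasFDerivAt
  exact HasFDerivAt.comp_hasDerivAt (f := fun s : ℝ => (![p 0, s] : Fin 2 → ℝ)) (x := p 1) h
    (hasDerivAt_vecCons_snd p (p 1))

/-- **Fibre derivative along `a`** of a function Fréchet differentiable at `p`: the fibre function
`s ↦ B (s, p 1)` has derivative `dB(p)[e₀]` at `p 0` (chain rule). [folklore] -/
theorem hasDerivAt_fibre_fst {B : (Fin 2 → ℝ) → ℝ} {p : Fin 2 → ℝ} (hB : DifferentiableAt ℝ B p) :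
    HasDerivAt (fun s : ℝ => B ![s, p 1]) (fderiv ℝ B p (Pi.single 0 1)) (p 0) := by
  have h : HasFDerivAt B (fderiv ℝ B p) ![p 0, p 1] := by
    rw [vecCons_apply_eq]
    exact hB.hasFDerivAt
  exact HasFDerivAt.comp_hasDerivAt (f := fun s : ℝ => (![s, p 1] : Fin 2 → ℝ)) (x := p 0) h
    (hasDerivAt_vecCons_fst p (p 0))

/-- The open standard triangle is open. [folklore] -/
theorem isOpen_openTriangle :
    IsOpen {p : Fin 2 → ℝ | 0 < p 0 ∧ 0 < p 1 ∧ p 0 + p 1 < 1} := by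
  refine (isOpen_lt continuous_const (continuous_apply 0)).inter
    ((isOpen_lt continuous_const (continuous_apply 1)).inter
      (isOpen_lt ((continuous_apply 0).add (continuous_apply 1)) continuous_const))

/-- **Mixed partials agree almost everywhere.** For `ℚ`-semialgebraic `A, B` on `Δ` with a `C¹`
potential `S` of `A da + B db` on the open triangle, off a `ℚ`-semialgebraic null set `Z` the fibre
functions `b ↦ A(a,b)` and `a ↦ B(a,b)` are differentiable with THE SAME derivative
`h = ∂_b A = ∂_a B`: semialgebraic functions are smooth off a `ℚ`-semialgebraic null set
(`KZ.exists_isOpen_contDiffOn`, from `IsSemialgebraicFunOn.exists_contDiffOn_holds` and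
`volume_frontier_eq_zero_of_isSemialgebraic`), and where `A, B` are differentiable the second
derivative of the potential `S` is symmetric (`second_derivative_symmetric_of_eventually_of_real`),
giving `∂_b A = ∂_a B`. [cite: KontsevichZagier2001, §1.2] -/
theorem stub_mixedPartials : ∀ (A B S : (Fin 2 → ℝ) → ℝ),
    IsSemialgebraicFunOn ℚ {p : Fin 2 → ℝ | 0 ≤ p 0 ∧ 0 ≤ p 1 ∧ p 0 + p 1 ≤ 1} A →
    IsSemialgebraicFunOn ℚ {p : Fin 2 → ℝ | 0 ≤ p 0 ∧ 0 ≤ p 1 ∧ p 0 + p 1 ≤ 1} B →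
    (∀ p : Fin 2 → ℝ, 0 < p 0 → 0 < p 1 → p 0 + p 1 < 1 →
      HasFDerivAt S (A p • ContinuousLinearMap.proj (R := ℝ) (φ := fun _ : Fin 2 => ℝ) 0 +
        B p • ContinuousLinearMap.proj (R := ℝ) (φ := fun _ : Fin 2 => ℝ) 1) p) →
    ∃ Z : Set (Fin 2 → ℝ), IsSemialgebraic ℚ Z ∧ volume Z = 0 ∧
      ∀ p : Fin 2 → ℝ, 0 < p 0 → 0 < p 1 → p 0 + p 1 < 1 → p ∉ Z →
        HasDerivAt (fun s : ℝ => A ![p 0, s]) (deriv (fun s : ℝ => A ![p 0, s]) (p 1)) (p 1) ∧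
        HasDerivAt (fun s : ℝ => B ![s, p 1]) (deriv (fun s : ℝ => A ![p 0, s]) (p 1)) (p 0) := by
  intro A B S hA hB hS
  have hΔ : IsSemialgebraic ℚ {p : Fin 2 → ℝ | 0 ≤ p 0 ∧ 0 ≤ p 1 ∧ p 0 + p 1 ≤ 1} :=
    IsSemialgebraicFunOn.isSemialgebraic_holds hA
  obtain ⟨GA, -, hGAo, -, hAsm, hZA, hZA0⟩ := KZ.exists_isOpen_contDiffOn hΔ hA
  obtain ⟨GB, -, hGBo, -, hBsm, hZB, hZB0⟩ := KZ.exists_isOpen_contDiffOn hΔ hB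
  refine ⟨({p : Fin 2 → ℝ | 0 ≤ p 0 ∧ 0 ≤ p 1 ∧ p 0 + p 1 ≤ 1} \ GA) ∪
      ({p : Fin 2 → ℝ | 0 ≤ p 0 ∧ 0 ≤ p 1 ∧ p 0 + p 1 ≤ 1} \ GB),
    hZA.union hZB, measure_union_null hZA0 hZB0, ?_⟩
  intro p h0 h1 h2 hpZ
  have hpΔ : p ∈ {p : Fin 2 → ℝ | 0 ≤ p 0 ∧ 0 ≤ p 1 ∧ p 0 + p 1 ≤ 1} := ⟨h0.le, h1.le, h2.le⟩
  have hpA : p ∈ GA := by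
    by_contra h
    exact hpZ (Or.inl ⟨hpΔ, h⟩)
  have hpB : p ∈ GB := by
    by_contra h
    exact hpZ (Or.inr ⟨hpΔ, h⟩)
  have hdA : DifferentiableAt ℝ A p :=
    (hAsm.differentiableOn (by simp)).differentiableAt (hGAo.mem_nhds hpA)
  have hdB : DifferentiableAt ℝ B p :=
    (hBsm.differentiableOn (by simp)).differentiableAt (hGBo.mem_nhds hpB)
  have hSev : ∀ᶠ y in 𝓝 p, HasFDerivAt S
      (A y • ContinuousLinearMap.proj (R := ℝ) (φ := fun _ : Fin 2 => ℝ) 0 +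
        B y • ContinuousLinearMap.proj (R := ℝ) (φ := fun _ : Fin 2 => ℝ) 1) y := by
    filter_upwards [isOpen_openTriangle.mem_nhds ⟨h0, h1, h2⟩] with y hy
    exact hS y hy.1 hy.2.1 hy.2.2
  have hkey := fderiv_apply_single_eq_of_potential hSev hdA hdB
  have hfA := hasDerivAt_fibre_snd hdA
  have hfB := hasDerivAt_fibre_fst hdB
  rw [hfA.deriv]
  exact ⟨hfA, hkey ▸ hfB⟩

end Summit.KontsevichZagierPeriods.SymplecticScissors.PlanarAreas

end
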